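import Literature.Analysis.FluidPDE.WholeSpaceIBP
import Literature.Analysis.FluidPDE.GaussianVortexPlanar
import HarnessLib

/-!
# Weighted energy identities for the strained-vorticity operator on compactly supported fields

Analysis/FluidPDE file (all results proved, no definitions, no named facts). For a `C²` weight
`ρ` on `ℝ²` and a compactly supported `C²` field `w` we prove the integrations by parts behind
Maekawa's energy estimates for the linearised Burgers problem (Maekawa 2009, §4.1–4.3:
"integration by parts" computations of `⟨(L + λM)h, h⟩_{X_λ}` in the weighted space
`X_λ = L²(G_λ⁻¹dx)`), in coordinates `e₀, e₁`:

* `integral_mul_fderiv_mul_fderiv_eq` — `∫ w ∂ᵥρ ∂ᵥw = −½ ∫ (∂ᵥ∂ᵥρ) w²`;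
* `integral_mul_mul_fderiv_fderiv_eq` — `∫ ρ w ∂ᵥ∂ᵥw = −∫ ρ (∂ᵥw)² + ½ ∫ (∂ᵥ∂ᵥρ) w²`;
* `integral_mul_mul_coord_mul_fderiv_eq` — `∫ ρ w xᵢ∂ᵢw = −½ ∫ (ρ + xᵢ∂ᵢρ) w²`;
* `integral_mul_mul_strainedVorticityOperator_eq` — **the weighted quadratic form of
  `L_λ = Δ + (1+λ)/2 x₀∂₀ + (1−λ)/2 x₁∂₁ + 1`** (`strainedVorticityOperator`, Gallay–Maekawa 2016,
  (4.3)): `∫ ρ w L_λw = −∫ ρ |∇w|² + ∫ V_ρ w²` with the explicit potential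
  `V_ρ = ½(∂₀∂₀ρ + ∂₁∂₁ρ) + ½ρ − ¼((1+λ)x₀∂₀ρ + (1−λ)x₁∂₁ρ)`.

No boundary or integrability conditions appear: every product has the compactly supported factor
`w` (Mathlib's `integral_mul_fderiv_eq_neg_fderiv_mul_of_integrable`).

## References

* Y. Maekawa, *Existence of asymmetric Burgers vortices and their asymptotic behavior at large
  circulations*, Math. Models Methods Appl. Sci. 19 (2009), §4.1 (proof of Prop. 4.1), §4.3
  (4.34). [Maekawa2009b]
* Th. Gallay, Y. Maekawa, *Existence and stability of viscous vortices*, arXiv:1610.08384, (4.3).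
  [GallayMaekawa2016]
-/

open MeasureTheory Filter Set Metric Function
open scoped Real RealInnerProductSpace Topology InnerProductSpace Laplacian

noncomputable section

namespace Literature.Analysis.FluidPDE

/-- Linear combinations of five integrable functions integrate termwise. [folklore] -/
theorem integral_lincomb₅ {f₁ f₂ f₃ f₄ f₅ : EuclideanSpace ℝ (Fin 2) → ℝ} (h₁ : Integrable f₁)
    (h₂ : Integrable f₂) (h₃ : Integrable f₃) (h₄ : Integrable f₄) (h₅ : Integrable f₅)
    (a₁ a₂ a₃ a₄ a₅ : ℝ) :
    ∫ x, (a₁ * f₁ x + a₂ * f₂ x + a₃ * f₃ x + a₄ * f₄ x + a₅ * f₅ x) =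
      a₁ * (∫ x, f₁ x) + a₂ * (∫ x, f₂ x) + a₃ * (∫ x, f₃ x) + a₄ * (∫ x, f₄ x) +
        a₅ * (∫ x, f₅ x) := by
  have g₁ : Integrable fun x => a₁ * f₁ x := h₁.const_mul _
  have g₂ : Integrable fun x => a₂ * f₂ x := h₂.const_mul _
  have g₃ : Integrable fun x => a₃ * f₃ x := h₃.const_mul _
  have g₄ : Integrable fun x => a₄ * f₄ x := h₄.const_mul _
  have g₅ : Integrable fun x => a₅ * f₅ x := h₅.const_mul _
  have s₂ : Integrable fun x => a₁ * f₁ x + a₂ * f₂ x := g₁.add g₂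
  have s₃ : Integrable fun x => a₁ * f₁ x + a₂ * f₂ x + a₃ * f₃ x := s₂.add g₃
  have s₄ : Integrable fun x => a₁ * f₁ x + a₂ * f₂ x + a₃ * f₃ x + a₄ * f₄ x := s₃.add g₄
  rw [integral_add s₄ g₅, integral_add s₃ g₄, integral_add s₂ g₃, integral_add g₁ g₂,
    integral_const_mul, integral_const_mul, integral_const_mul, integral_const_mul,
    integral_const_mul]

section Weighted

variable {ρ w : EuclideanSpace ℝ (Fin 2) → ℝ} (hwc : HasCompactSupport w)
include hwc

omit hwc in
/-- The square of a compactly supported function is compactly supported. [folklore] -/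
private theorem hasCompactSupport_sq {g : EuclideanSpace ℝ (Fin 2) → ℝ} (hg : HasCompactSupport g) :
    HasCompactSupport fun x => g x ^ 2 :=
  hg.comp_left (g := fun t : ℝ => t ^ 2) (by simp)

/-- **`∫ w ∂ᵥρ ∂ᵥw = −½ ∫ (∂ᵥ∂ᵥρ) w²`** for `ρ ∈ C²`, `w ∈ C¹_c`. [folklore] -/
theorem integral_mul_fderiv_mul_fderiv_eq (hρ : ContDiff ℝ 2 ρ) (hw : ContDiff ℝ 1 w)
    (v : EuclideanSpace ℝ (Fin 2)) :
    ∫ x, w x * fderiv ℝ ρ x v * fderiv ℝ w x v =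
      -(1 / 2) * ∫ x, fderiv ℝ (fun y => fderiv ℝ ρ y v) x v * w x ^ 2 := by
  have hρ1 : ContDiff ℝ 1 fun y => fderiv ℝ ρ y v :=
    (hρ.fderiv_right (m := 1) le_rfl).clm_apply contDiff_const
  -- `F = w ∂ᵥρ`, `G = w`
  have hF : ContDiff ℝ 1 fun y => w y * fderiv ℝ ρ y v := hw.mul hρ1
  have hFd : ∀ x, fderiv ℝ (fun y => w y * fderiv ℝ ρ y v) x v =
      fderiv ℝ w x v * fderiv ℝ ρ x v + w x * fderiv ℝ (fun y => fderiv ℝ ρ y v) x v := by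
    intro x
    have h1 : HasFDerivAt w (fderiv ℝ w x) x := ((hw.differentiable one_ne_zero) x).hasFDerivAt
    have h2 : HasFDerivAt (fun y => fderiv ℝ ρ y v) (fderiv ℝ (fun y => fderiv ℝ ρ y v) x) x :=
      ((hρ1.differentiable one_ne_zero) x).hasFDerivAt
    rw [(h1.fun_mul h2).fderiv]
    simp only [_root_.add_apply, _root_.smul_apply, smul_eq_mul]
    ring
  have hwc' : HasCompactSupport fun y => fderiv ℝ w y v := hwc.fderiv_apply (𝕜 := ℝ) v
  have hcw' : Continuous fun y => fderiv ℝ w y v :=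
    (hw.continuous_fderiv one_ne_zero).clm_apply continuous_const
  have hcF' : Continuous fun y => fderiv ℝ (fun y => w y * fderiv ℝ ρ y v) y v :=
    (hF.continuous_fderiv one_ne_zero).clm_apply continuous_const
  have i1 : Integrable fun x => fderiv ℝ (fun y => w y * fderiv ℝ ρ y v) x v * w x :=
    (hcF'.mul hw.continuous).integrable_of_hasCompactSupport hwc.mul_left
  have i2 : Integrable fun x => w x * fderiv ℝ ρ x v * fderiv ℝ w x v :=
    (hF.continuous.mul hcw').integrable_of_hasCompactSupport hwc'.mul_left
  have i3 : Integrable fun x => w x * fderiv ℝ ρ x v * w x :=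
    (hF.continuous.mul hw.continuous).integrable_of_hasCompactSupport hwc.mul_left
  have ibp := integral_mul_fderiv_eq_neg_fderiv_mul_of_integrable i1 i2 i3
    (fun x _ => (hF.differentiable one_ne_zero) x) (fun x _ => (hw.differentiable one_ne_zero) x)
  simp_rw [hFd] at ibp
  have hsplit : (∫ x, (fderiv ℝ w x v * fderiv ℝ ρ x v +
      w x * fderiv ℝ (fun y => fderiv ℝ ρ y v) x v) * w x) =
      (∫ x, w x * fderiv ℝ ρ x v * fderiv ℝ w x v) +
        ∫ x, fderiv ℝ (fun y => fderiv ℝ ρ y v) x v * w x ^ 2 := by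
    have j2 : Integrable fun x => fderiv ℝ (fun y => fderiv ℝ ρ y v) x v * w x ^ 2 :=
      (((hρ1.continuous_fderiv one_ne_zero).clm_apply continuous_const).mul
        (hw.continuous.pow 2)).integrable_of_hasCompactSupport (hasCompactSupport_sq hwc).mul_left
    rw [← integral_add i2 j2]
    exact integral_congr_ae (Eventually.of_forall fun x => by ring)
  rw [hsplit] at ibp
  linarith

/-- **`∫ ρ w ∂ᵥ∂ᵥw = −∫ ρ (∂ᵥw)² + ½ ∫ (∂ᵥ∂ᵥρ) w²`** for `ρ ∈ C²`, `w ∈ C²_c`. [folklore] -/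
theorem integral_mul_mul_fderiv_fderiv_eq (hρ : ContDiff ℝ 2 ρ) (hw : ContDiff ℝ 2 w)
    (v : EuclideanSpace ℝ (Fin 2)) :
    ∫ x, ρ x * w x * fderiv ℝ (fun y => fderiv ℝ w y v) x v =
      -(∫ x, ρ x * (fderiv ℝ w x v) ^ 2) +
        (1 / 2) * ∫ x, fderiv ℝ (fun y => fderiv ℝ ρ y v) x v * w x ^ 2 := by
  have hw1 : ContDiff ℝ 1 w := hw.of_le one_le_two
  have hρ1' : ContDiff ℝ 1 ρ := hρ.of_le one_le_two
  have hw' : ContDiff ℝ 1 fun y => fderiv ℝ w y v :=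
    (hw.fderiv_right (m := 1) le_rfl).clm_apply contDiff_const
  -- `F = ρ w`, `G = ∂ᵥw`
  have hF : ContDiff ℝ 1 fun y => ρ y * w y := hρ1'.mul hw1
  have hFd : ∀ x, fderiv ℝ (fun y => ρ y * w y) x v =
      fderiv ℝ ρ x v * w x + ρ x * fderiv ℝ w x v := by
    intro x
    have h1 : HasFDerivAt ρ (fderiv ℝ ρ x) x := ((hρ1'.differentiable one_ne_zero) x).hasFDerivAt
    have h2 : HasFDerivAt w (fderiv ℝ w x) x := ((hw1.differentiable one_ne_zero) x).hasFDerivAt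
    rw [(h1.fun_mul h2).fderiv]
    simp only [_root_.add_apply, _root_.smul_apply, smul_eq_mul]
    ring
  have hwc' : HasCompactSupport fun y => fderiv ℝ w y v := hwc.fderiv_apply (𝕜 := ℝ) v
  have hwc'' : HasCompactSupport fun y => fderiv ℝ (fun y => fderiv ℝ w y v) y v :=
    hwc'.fderiv_apply (𝕜 := ℝ) v
  have hcw'' : Continuous fun y => fderiv ℝ (fun y => fderiv ℝ w y v) y v :=
    (hw'.continuous_fderiv one_ne_zero).clm_apply continuous_const
  have hcF' : Continuous fun y => fderiv ℝ (fun y => ρ y * w y) y v :=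
    (hF.continuous_fderiv one_ne_zero).clm_apply continuous_const
  have i1 : Integrable fun x => fderiv ℝ (fun y => ρ y * w y) x v * fderiv ℝ w x v :=
    (hcF'.mul hw'.continuous).integrable_of_hasCompactSupport hwc'.mul_left
  have i2 : Integrable fun x => ρ x * w x * fderiv ℝ (fun y => fderiv ℝ w y v) x v :=
    (hF.continuous.mul hcw'').integrable_of_hasCompactSupport hwc''.mul_left
  have i3 : Integrable fun x => ρ x * w x * fderiv ℝ w x v :=
    (hF.continuous.mul hw'.continuous).integrable_of_hasCompactSupport hwc'.mul_left
  have ibp := integral_mul_fderiv_eq_neg_fderiv_mul_of_integrable i1 i2 i3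
    (fun x _ => (hF.differentiable one_ne_zero) x) (fun x _ => (hw'.differentiable one_ne_zero) x)
  simp_rw [hFd] at ibp
  have hsplit : (∫ x, (fderiv ℝ ρ x v * w x + ρ x * fderiv ℝ w x v) * fderiv ℝ w x v) =
      (∫ x, w x * fderiv ℝ ρ x v * fderiv ℝ w x v) + ∫ x, ρ x * (fderiv ℝ w x v) ^ 2 := by
    have j1 : Integrable fun x => w x * fderiv ℝ ρ x v * fderiv ℝ w x v :=
      ((hw1.continuous.mul ((hρ1'.continuous_fderiv one_ne_zero).clm_apply continuous_const)).mul
        hw'.continuous).integrable_of_hasCompactSupport hwc'.mul_left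
    have j2 : Integrable fun x => ρ x * (fderiv ℝ w x v) ^ 2 :=
      (hρ1'.continuous.mul (hw'.continuous.pow 2)).integrable_of_hasCompactSupport
        (hasCompactSupport_sq hwc').mul_left
    rw [← integral_add j1 j2]
    exact integral_congr_ae (Eventually.of_forall fun x => by ring)
  rw [hsplit, integral_mul_fderiv_mul_fderiv_eq hwc hρ hw1 v] at ibp
  linarith

/-- **`∫ ρ w xᵢ∂ᵢw = −½ ∫ (ρ + xᵢ∂ᵢρ) w²`** for `ρ ∈ C¹`, `w ∈ C¹_c` (`∂ᵢxᵢ = 1`). [folklore] -/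
theorem integral_mul_mul_coord_mul_fderiv_eq (hρ : ContDiff ℝ 1 ρ) (hw : ContDiff ℝ 1 w)
    (i : Fin 2) :
    ∫ x, ρ x * w x * (x i * fderiv ℝ w x (EuclideanSpace.single i 1)) =
      -(1 / 2) * ∫ x, (ρ x + x i * fderiv ℝ ρ x (EuclideanSpace.single i 1)) * w x ^ 2 := by
  have hpi : ContDiff ℝ 1 fun x : EuclideanSpace ℝ (Fin 2) => x i :=
    (EuclideanSpace.proj (i : Fin 2) : EuclideanSpace ℝ (Fin 2) →L[ℝ] ℝ).contDiff
  -- `F = ρ xᵢ w`, `G = w`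
  have hF : ContDiff ℝ 1 fun y : EuclideanSpace ℝ (Fin 2) => ρ y * y i * w y := (hρ.mul hpi).mul hw
  have hFd : ∀ x, fderiv ℝ (fun y : EuclideanSpace ℝ (Fin 2) => ρ y * y i * w y) x
      (EuclideanSpace.single i 1) =
      fderiv ℝ ρ x (EuclideanSpace.single i 1) * x i * w x + ρ x * w x +
        ρ x * x i * fderiv ℝ w x (EuclideanSpace.single i 1) := by
    intro x
    have h1 : HasFDerivAt ρ (fderiv ℝ ρ x) x := ((hρ.differentiable one_ne_zero) x).hasFDerivAt
    have h2 : HasFDerivAt (fun y : EuclideanSpace ℝ (Fin 2) => y i)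
        (EuclideanSpace.proj i : EuclideanSpace ℝ (Fin 2) →L[ℝ] ℝ) x :=
      (EuclideanSpace.proj (i : Fin 2) : EuclideanSpace ℝ (Fin 2) →L[ℝ] ℝ).hasFDerivAt
    have h3 : HasFDerivAt w (fderiv ℝ w x) x := ((hw.differentiable one_ne_zero) x).hasFDerivAt
    rw [((h1.fun_mul h2).fun_mul h3).fderiv]
    simp only [_root_.add_apply, _root_.smul_apply, smul_eq_mul]
    simp
    ring
  have hwc' : HasCompactSupport fun y => fderiv ℝ w y (EuclideanSpace.single i 1) :=
    hwc.fderiv_apply (𝕜 := ℝ) _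
  have hcw' : Continuous fun y => fderiv ℝ w y (EuclideanSpace.single i 1) :=
    (hw.continuous_fderiv one_ne_zero).clm_apply continuous_const
  have hcF' : Continuous fun y => fderiv ℝ (fun y : EuclideanSpace ℝ (Fin 2) => ρ y * y i * w y) y
      (EuclideanSpace.single i 1) :=
    (hF.continuous_fderiv one_ne_zero).clm_apply continuous_const
  have i1 : Integrable fun x => fderiv ℝ (fun y : EuclideanSpace ℝ (Fin 2) => ρ y * y i * w y) x
      (EuclideanSpace.single i 1) * w x :=
    (hcF'.mul hw.continuous).integrable_of_hasCompactSupport hwc.mul_left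
  have i2 : Integrable fun x : EuclideanSpace ℝ (Fin 2) => ρ x * x i * w x *
      fderiv ℝ w x (EuclideanSpace.single i 1) :=
    (hF.continuous.mul hcw').integrable_of_hasCompactSupport hwc'.mul_left
  have i3 : Integrable fun x : EuclideanSpace ℝ (Fin 2) => ρ x * x i * w x * w x :=
    (hF.continuous.mul hw.continuous).integrable_of_hasCompactSupport hwc.mul_left
  have ibp := integral_mul_fderiv_eq_neg_fderiv_mul_of_integrable i1 i2 i3
    (fun x _ => (hF.differentiable one_ne_zero) x) (fun x _ => (hw.differentiable one_ne_zero) x)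
  simp_rw [hFd] at ibp
  have hc1 : Continuous fun x : EuclideanSpace ℝ (Fin 2) =>
      fderiv ℝ ρ x (EuclideanSpace.single i 1) :=
    (hρ.continuous_fderiv one_ne_zero).clm_apply continuous_const
  have hsplit : (∫ x : EuclideanSpace ℝ (Fin 2),
      (fderiv ℝ ρ x (EuclideanSpace.single i 1) * x i * w x + ρ x * w x +
        ρ x * x i * fderiv ℝ w x (EuclideanSpace.single i 1)) * w x) =
      (∫ x : EuclideanSpace ℝ (Fin 2),
        (ρ x + x i * fderiv ℝ ρ x (EuclideanSpace.single i 1)) * w x ^ 2) +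
        ∫ x : EuclideanSpace ℝ (Fin 2),
          ρ x * w x * (x i * fderiv ℝ w x (EuclideanSpace.single i 1)) := by
    have j1 : Integrable fun x : EuclideanSpace ℝ (Fin 2) =>
        (ρ x + x i * fderiv ℝ ρ x (EuclideanSpace.single i 1)) * w x ^ 2 :=
      ((hρ.continuous.add (hpi.continuous.mul hc1)).mul (hw.continuous.pow 2))
        |>.integrable_of_hasCompactSupport (hasCompactSupport_sq hwc).mul_left
    have j2 : Integrable fun x : EuclideanSpace ℝ (Fin 2) =>
        ρ x * w x * (x i * fderiv ℝ w x (EuclideanSpace.single i 1)) :=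
      ((hρ.continuous.mul hw.continuous).mul (hpi.continuous.mul hcw'))
        |>.integrable_of_hasCompactSupport (hwc'.mul_left).mul_left
    rw [← integral_add j1 j2]
    exact integral_congr_ae (Eventually.of_forall fun x => by ring)
  have hL : (∫ x : EuclideanSpace ℝ (Fin 2),
      ρ x * x i * w x * fderiv ℝ w x (EuclideanSpace.single i 1)) =
      ∫ x : EuclideanSpace ℝ (Fin 2),
        ρ x * w x * (x i * fderiv ℝ w x (EuclideanSpace.single i 1)) :=
    integral_congr_ae (Eventually.of_forall fun x => by ring)
  rw [hsplit, hL] at ibp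
  linarith

/-- **The weighted quadratic form of `L_λ`.** For a `C²` weight `ρ` and `w ∈ C²_c(ℝ²)`,
`∫ ρ w L_λw = −∫ ρ ((∂₀w)² + (∂₁w)²) + ∫ V w²`,
`V = ½(∂₀∂₀ρ + ∂₁∂₁ρ) + ½ρ − ¼((1+λ)x₀∂₀ρ + (1−λ)x₁∂₁ρ)`,
where `L_λ = Δ + (1+λ)/2 x₀∂₀ + (1−λ)/2 x₁∂₁ + 1 = strainedVorticityOperator lam` (the
integrations by parts of Maekawa 2009, §4.1/§4.3, for an arbitrary weight; with
`ρ = G_λ⁻¹ = e^{(1−λ)|x|²/4}` this is the `X_λ` form). [cite: Maekawa2009b, §4.3 (4.34)] -/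
theorem integral_mul_mul_strainedVorticityOperator_eq (hρ : ContDiff ℝ 2 ρ) (hw : ContDiff ℝ 2 w)
    (lam : ℝ) :
    ∫ x, ρ x * w x * strainedVorticityOperator lam w x =
      -(∫ x, ρ x * ((fderiv ℝ w x (EuclideanSpace.single 0 1)) ^ 2 +
          (fderiv ℝ w x (EuclideanSpace.single 1 1)) ^ 2)) +
        ∫ x, ((1 / 2) * (fderiv ℝ (fun y => fderiv ℝ ρ y (EuclideanSpace.single 0 1)) x
              (EuclideanSpace.single 0 1) +
            fderiv ℝ (fun y => fderiv ℝ ρ y (EuclideanSpace.single 1 1)) x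
              (EuclideanSpace.single 1 1)) + (1 / 2) * ρ x -
          (1 / 4) * ((1 + lam) * (x 0 * fderiv ℝ ρ x (EuclideanSpace.single 0 1)) +
            (1 - lam) * (x 1 * fderiv ℝ ρ x (EuclideanSpace.single 1 1)))) * w x ^ 2 := by
  have hw1 : ContDiff ℝ 1 w := hw.of_le one_le_two
  have hρ1 : ContDiff ℝ 1 ρ := hρ.of_le one_le_two
  -- abbreviations for the coordinate derivatives
  set w0 : EuclideanSpace ℝ (Fin 2) → ℝ :=
    fun x => fderiv ℝ w x (EuclideanSpace.single 0 1) with hw0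
  set w1' : EuclideanSpace ℝ (Fin 2) → ℝ :=
    fun x => fderiv ℝ w x (EuclideanSpace.single 1 1) with hw1'
  set w00 : EuclideanSpace ℝ (Fin 2) → ℝ :=
    fun x => fderiv ℝ w0 x (EuclideanSpace.single 0 1) with hw00
  set w11 : EuclideanSpace ℝ (Fin 2) → ℝ :=
    fun x => fderiv ℝ w1' x (EuclideanSpace.single 1 1) with hw11
  set ρ0 : EuclideanSpace ℝ (Fin 2) → ℝ :=
    fun x => fderiv ℝ ρ x (EuclideanSpace.single 0 1) with hρ0
  set ρ1' : EuclideanSpace ℝ (Fin 2) → ℝ :=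
    fun x => fderiv ℝ ρ x (EuclideanSpace.single 1 1) with hρ1d
  set ρ00 : EuclideanSpace ℝ (Fin 2) → ℝ :=
    fun x => fderiv ℝ ρ0 x (EuclideanSpace.single 0 1) with hρ00
  set ρ11 : EuclideanSpace ℝ (Fin 2) → ℝ :=
    fun x => fderiv ℝ ρ1' x (EuclideanSpace.single 1 1) with hρ11
  -- continuity / compact support bookkeeping
  have cw0 : Continuous w0 := (hw1.continuous_fderiv one_ne_zero).clm_apply continuous_const
  have cw1 : Continuous w1' := (hw1.continuous_fderiv one_ne_zero).clm_apply continuous_const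
  have dw0 : ContDiff ℝ 1 w0 := (hw.fderiv_right (m := 1) le_rfl).clm_apply contDiff_const
  have dw1 : ContDiff ℝ 1 w1' := (hw.fderiv_right (m := 1) le_rfl).clm_apply contDiff_const
  have cw00 : Continuous w00 := (dw0.continuous_fderiv one_ne_zero).clm_apply continuous_const
  have cw11 : Continuous w11 := (dw1.continuous_fderiv one_ne_zero).clm_apply continuous_const
  have cρ0 : Continuous ρ0 := (hρ1.continuous_fderiv one_ne_zero).clm_apply continuous_const
  have cρ1 : Continuous ρ1' := (hρ1.continuous_fderiv one_ne_zero).clm_apply continuous_const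
  have dρ0 : ContDiff ℝ 1 ρ0 := (hρ.fderiv_right (m := 1) le_rfl).clm_apply contDiff_const
  have dρ1 : ContDiff ℝ 1 ρ1' := (hρ.fderiv_right (m := 1) le_rfl).clm_apply contDiff_const
  have cρ00 : Continuous ρ00 := (dρ0.continuous_fderiv one_ne_zero).clm_apply continuous_const
  have cρ11 : Continuous ρ11 := (dρ1.continuous_fderiv one_ne_zero).clm_apply continuous_const
  have hp : ∀ j : Fin 2, Continuous fun x : EuclideanSpace ℝ (Fin 2) => x j := fun j =>
    (EuclideanSpace.proj (j : Fin 2) : EuclideanSpace ℝ (Fin 2) →L[ℝ] ℝ).continuous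
  have sw0 : HasCompactSupport w0 := hwc.fderiv_apply (𝕜 := ℝ) _
  have sw1 : HasCompactSupport w1' := hwc.fderiv_apply (𝕜 := ℝ) _
  have sw00 : HasCompactSupport w00 := sw0.fderiv_apply (𝕜 := ℝ) _
  have sw11 : HasCompactSupport w11 := sw1.fderiv_apply (𝕜 := ℝ) _
  -- the Laplacian in coordinates
  have hΔ : ∀ x, Δ w x = w00 x + w11 x := fun x => by
    have := laplacian_eq_sum_fderiv_fderiv (EuclideanSpace.basisFun (Fin 2) ℝ) hw x
    simpa [Fin.sum_univ_two, EuclideanSpace.basisFun_apply] using this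
  -- expand the integrand
  have hexp : ∀ x, ρ x * w x * strainedVorticityOperator lam w x =
      ρ x * w x * w00 x + ρ x * w x * w11 x +
      (1 + lam) / 2 * (ρ x * w x * (x 0 * w0 x)) + (1 - lam) / 2 * (ρ x * w x * (x 1 * w1' x)) +
      ρ x * w x ^ 2 := by
    intro x
    rw [strainedVorticityOperator, hΔ x]
    ring
  simp_rw [hexp]
  -- integrability of the five pieces
  have hρw : Continuous fun x => ρ x * w x := hρ1.continuous.mul hw1.continuous
  have sρw : HasCompactSupport fun x => ρ x * w x := hwc.mul_left
  have I1 : Integrable fun x => ρ x * w x * w00 x :=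
    (hρw.mul cw00).integrable_of_hasCompactSupport sw00.mul_left
  have I2 : Integrable fun x => ρ x * w x * w11 x :=
    (hρw.mul cw11).integrable_of_hasCompactSupport sw11.mul_left
  have I3 : Integrable fun x : EuclideanSpace ℝ (Fin 2) =>
      (1 + lam) / 2 * (ρ x * w x * (x 0 * w0 x)) :=
    ((hρw.mul ((hp 0).mul cw0)).integrable_of_hasCompactSupport
      (sw0.mul_left.mul_left)).const_mul _
  have I4 : Integrable fun x : EuclideanSpace ℝ (Fin 2) =>
      (1 - lam) / 2 * (ρ x * w x * (x 1 * w1' x)) :=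
    ((hρw.mul ((hp 1).mul cw1)).integrable_of_hasCompactSupport
      (sw1.mul_left.mul_left)).const_mul _
  have I5 : Integrable fun x => ρ x * w x ^ 2 :=
    (hρ1.continuous.mul (hw1.continuous.pow 2)).integrable_of_hasCompactSupport
      (hasCompactSupport_sq hwc).mul_left
  -- the seven basic integrals are of integrable functions
  have J1 : Integrable fun x => ρ x * (w0 x) ^ 2 :=
    (hρ1.continuous.mul (cw0.pow 2)).integrable_of_hasCompactSupport
      (hasCompactSupport_sq sw0).mul_left
  have J2 : Integrable fun x => ρ x * (w1' x) ^ 2 :=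
    (hρ1.continuous.mul (cw1.pow 2)).integrable_of_hasCompactSupport
      (hasCompactSupport_sq sw1).mul_left
  have J3 : Integrable fun x => ρ00 x * w x ^ 2 :=
    (cρ00.mul (hw1.continuous.pow 2)).integrable_of_hasCompactSupport
      (hasCompactSupport_sq hwc).mul_left
  have J4 : Integrable fun x => ρ11 x * w x ^ 2 :=
    (cρ11.mul (hw1.continuous.pow 2)).integrable_of_hasCompactSupport
      (hasCompactSupport_sq hwc).mul_left
  have J6 : Integrable fun x : EuclideanSpace ℝ (Fin 2) => x 0 * ρ0 x * w x ^ 2 :=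
    (((hp 0).mul cρ0).mul (hw1.continuous.pow 2)).integrable_of_hasCompactSupport
      (hasCompactSupport_sq hwc).mul_left
  have J7 : Integrable fun x : EuclideanSpace ℝ (Fin 2) => x 1 * ρ1' x * w x ^ 2 :=
    (((hp 1).mul cρ1).mul (hw1.continuous.pow 2)).integrable_of_hasCompactSupport
      (hasCompactSupport_sq hwc).mul_left
  -- (a) the left-hand side, termwise
  have hA : (∫ x : EuclideanSpace ℝ (Fin 2), ρ x * w x * w00 x + ρ x * w x * w11 x +
      (1 + lam) / 2 * (ρ x * w x * (x 0 * w0 x)) + (1 - lam) / 2 * (ρ x * w x * (x 1 * w1' x)) +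
      ρ x * w x ^ 2) =
      1 * (∫ x, ρ x * w x * w00 x) + 1 * (∫ x, ρ x * w x * w11 x) +
      (1 + lam) / 2 * (∫ x : EuclideanSpace ℝ (Fin 2), ρ x * w x * (x 0 * w0 x)) +
      (1 - lam) / 2 * (∫ x : EuclideanSpace ℝ (Fin 2), ρ x * w x * (x 1 * w1' x)) +
      1 * (∫ x, ρ x * w x ^ 2) := by
    have I3' : Integrable fun x : EuclideanSpace ℝ (Fin 2) => ρ x * w x * (x 0 * w0 x) :=
      (hρw.mul ((hp 0).mul cw0)).integrable_of_hasCompactSupport (sw0.mul_left.mul_left)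
    have I4' : Integrable fun x : EuclideanSpace ℝ (Fin 2) => ρ x * w x * (x 1 * w1' x) :=
      (hρw.mul ((hp 1).mul cw1)).integrable_of_hasCompactSupport (sw1.mul_left.mul_left)
    rw [← integral_lincomb₅ I1 I2 I3' I4' I5]
    exact integral_congr_ae (Eventually.of_forall fun x => by ring)
  -- (b), (c), (d): the right-hand side pieces, termwise
  have hB : (∫ x, ρ x * ((w0 x) ^ 2 + (w1' x) ^ 2)) =
      (∫ x, ρ x * (w0 x) ^ 2) + ∫ x, ρ x * (w1' x) ^ 2 := by
    rw [← integral_add J1 J2]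
    exact integral_congr_ae (Eventually.of_forall fun x => by ring)
  have hC : (∫ x : EuclideanSpace ℝ (Fin 2), ((1 / 2) * (ρ00 x + ρ11 x) + (1 / 2) * ρ x -
      (1 / 4) * ((1 + lam) * (x 0 * ρ0 x) + (1 - lam) * (x 1 * ρ1' x))) * w x ^ 2) =
      (1 / 2) * (∫ x, ρ00 x * w x ^ 2) + (1 / 2) * (∫ x, ρ11 x * w x ^ 2) +
      (1 / 2) * (∫ x, ρ x * w x ^ 2) +
      (-((1 + lam) / 4)) * (∫ x : EuclideanSpace ℝ (Fin 2), x 0 * ρ0 x * w x ^ 2) +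
      (-((1 - lam) / 4)) * (∫ x : EuclideanSpace ℝ (Fin 2), x 1 * ρ1' x * w x ^ 2) := by
    rw [← integral_lincomb₅ J3 J4 I5 J6 J7]
    exact integral_congr_ae (Eventually.of_forall fun x => by ring)
  have hD0 : (∫ x : EuclideanSpace ℝ (Fin 2), (ρ x + x 0 * ρ0 x) * w x ^ 2) =
      (∫ x, ρ x * w x ^ 2) + ∫ x : EuclideanSpace ℝ (Fin 2), x 0 * ρ0 x * w x ^ 2 := by
    rw [← integral_add I5 J6]
    exact integral_congr_ae (Eventually.of_forall fun x => by ring)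
  have hD1 : (∫ x : EuclideanSpace ℝ (Fin 2), (ρ x + x 1 * ρ1' x) * w x ^ 2) =
      (∫ x, ρ x * w x ^ 2) + ∫ x : EuclideanSpace ℝ (Fin 2), x 1 * ρ1' x * w x ^ 2 := by
    rw [← integral_add I5 J7]
    exact integral_congr_ae (Eventually.of_forall fun x => by ring)
  -- the four integrations by parts
  have hT1 := integral_mul_mul_fderiv_fderiv_eq hwc hρ hw (EuclideanSpace.single 0 1)
  have hT2 := integral_mul_mul_fderiv_fderiv_eq hwc hρ hw (EuclideanSpace.single 1 1)
  have hT3 := integral_mul_mul_coord_mul_fderiv_eq hwc hρ1 hw1 0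
  have hT4 := integral_mul_mul_coord_mul_fderiv_eq hwc hρ1 hw1 1
  rw [hA, hB, hC, hT1, hT2, hT3, hT4, hD0, hD1]
  ring

end Weighted

end Literature.Analysis.FluidPDE
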